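import Mathlib
import Summits.SmoothPoincare4.SmoothPoincare4.Theorems.SoloInformedPerfectCenterRigid

/-!
# Fundamental group of surgery on a mapping torus along a section: the algebraic core

Solo unit `solo-SmoothPoincare4-informed`, session 11 (HOME `paper/poincare-sphere-trick.md`,
§10 Lemma `T_P` and §11 Proposition 11.2 (ii)–(iii)).

Topological dictionary (prose; the topology is NOT formalised here).  Let `F` be a closed
3-manifold with `G = π₁ F`, `φ̂ : F → F` a diffeomorphism inducing `φ = φ̂_*` on `G`, and
`W = F ×_φ̂ S¹` its mapping torus, `π₁ W = G ⋊_φ ℤ = ⟨G, t | t x t⁻¹ = φ x⟩`.  A section of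
`W → S¹` in the class of the loop `w · t` (`w ∈ G`) has a neighbourhood `S¹ × D³`; surgery on it
(replace by `D² × S²`, either framing) kills `w t`, so
`π₁ = (G ⋊_φ ℤ) / ⟪w t⟫ = G / ⟪ x⁻¹ · w · φ(x) · w⁻¹ : x ∈ G ⟫` (substitute `t = w⁻¹`).
The set `sectionRelators φ w` below is exactly this relator set.  When `φ` is INNER,
`φ = μ_q` (conjugation by `q`) — the case of the Poincaré sphere `P` (`π₀ Diff P = 1`, §10) and of
the spherical space forms `M_d = S³/(I* × ℤ_d)` whose realisable automorphisms are inner on `I*`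
(Plotnick–Suciu 1987 p. 525: `σ = (μ_g, −1)`) — three purely group-theoretic facts organise the
whole census of §10–§11:

* `sectionRelator_conj`: `x⁻¹ · w · (q x q⁻¹) · w⁻¹ = ⁅x⁻¹, w q⁆`, so the quotient is
  `G / ⟪⁅y, g⁆ : y⟫` with `g := w q` ("the class `g = w′q₁`" of Prop. 11.2 (ii));
* `twistedConj_iff_isConj`: two sections `w₁ t`, `w₂ t` are related by the `φ`-twisted conjugacy
  `w ↦ x w φ(x)⁻¹` (change of base path / isotopy of the section through the fibre) iff `w₁ q` and
  `w₂ q` are conjugate — so section classes ↔ conjugacy classes of `G` (9 for `I* = SL(2,5)`);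
* `normalClosure_commutators_eq_top_iff`: if `G` is perfect and every normal subgroup of `G` is
  central or everything (true for `I* = SL(2,5)`, whose proper normal subgroups are `1` and `{±1}`),
  then `G / ⟪⁅y, g⁆ : y⟫` is trivial iff `g` is NOT central — "killing class ⟺ noncentral"
  (Prop. 11.2 (iii): 7 of the 9 classes; Lemma `T_P` Step 1).

The `ℤ_d`-factor with the inversion automorphism contributes only squares (`inversionRelator`), which
generate `ℤ_d` for `d` odd; `normalClosure_sectionRelators_prod_eq_top` assembles the product case
`G × A`, `φ = μ_q × (a ↦ a⁻¹)`, and `normalClosure_sectionRelators_fst` is the converse projection.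
Everything here is elementary group theory over Mathlib; the only project import is the session-9
lemma `PerfectProd.eq_self_of_perfect_of_central_difference` (a perfect group has no non-identity
endomorphism that is the identity modulo the centre).
-/

namespace Summit.SmoothPoincare4.SmoothPoincare4.Theorems
namespace SectionSurgery

open Subgroup
open scoped commutatorElement

variable {G : Type*} [Group G]

/-- The relators `x⁻¹ · w · φ x · w⁻¹` (`x ∈ G`) presenting `π₁` of the surgery on the mapping torus
of `φ` along the section in the class `w · t`. -/
def sectionRelators (φ : G →* G) (w : G) : Set G :=
  Set.range fun x : G => x⁻¹ * w * φ x * w⁻¹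

/-- Each relator `x⁻¹ · w · φ x · w⁻¹` belongs to the relator set. -/
theorem mem_sectionRelators (φ : G →* G) (w x : G) :
    x⁻¹ * w * φ x * w⁻¹ ∈ sectionRelators φ w := ⟨x, rfl⟩

/-- For an inner monodromy `φ = μ_q` the section relator at `x` is the commutator `⁅x⁻¹, w q⁆`. -/
theorem sectionRelator_conj (q w x : G) :
    x⁻¹ * w * (MulAut.conj q x) * w⁻¹ = ⁅x⁻¹, w * q⁆ := by
  rw [MulAut.conj_apply, commutatorElement_def]
  group

/-- Hence the relator SET for `φ = μ_q` is the set of commutators with `g = w q`. -/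
theorem sectionRelators_conj_eq (q w : G) :
    sectionRelators (MulAut.conj q).toMonoidHom w = Set.range fun y : G => ⁅y, w * q⁆ := by
  ext z
  constructor
  · rintro ⟨x, rfl⟩
    exact ⟨x⁻¹, by
      simp only [MulEquiv.coe_toMonoidHom, MulAut.conj_apply, commutatorElement_def]; group⟩
  · rintro ⟨y, rfl⟩
    exact ⟨y⁻¹, by
      simp only [MulEquiv.coe_toMonoidHom, MulAut.conj_apply, commutatorElement_def]; group⟩

/-- Section classes versus conjugacy classes: `w₂ = x · w₁ · φ(x)⁻¹` for some `x`, with `φ = μ_q`,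
iff `w₁ q` and `w₂ q` are conjugate. -/
theorem twistedConj_iff_isConj (q w₁ w₂ : G) :
    (∃ x : G, w₂ = x * w₁ * (q * x⁻¹ * q⁻¹)) ↔ IsConj (w₁ * q) (w₂ * q) := by
  rw [isConj_iff]
  constructor
  · rintro ⟨x, rfl⟩
    exact ⟨x, by group⟩
  · rintro ⟨c, hc⟩
    refine ⟨c, ?_⟩
    calc w₂ = (w₂ * q) * q⁻¹ := by group
      _ = c * (w₁ * q) * c⁻¹ * q⁻¹ := by rw [hc]
      _ = c * w₁ * (q * c⁻¹ * q⁻¹) := by group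

/-- If `g` is central, all commutators with `g` vanish and their normal closure is trivial. -/
theorem normalClosure_commutators_eq_bot_of_mem_center {g : G} (hg : g ∈ center G) :
    normalClosure (Set.range fun y : G => ⁅y, g⁆) = ⊥ := by
  rw [eq_bot_iff]
  refine normalClosure_le_normal ?_
  rintro _ ⟨y, rfl⟩
  rw [SetLike.mem_coe, Subgroup.mem_bot]
  show ⁅y, g⁆ = 1
  rw [commutatorElement_def]
  have h := (Subgroup.mem_center_iff.mp hg) y
  calc y * g * y⁻¹ * g⁻¹ = (y * g) * y⁻¹ * g⁻¹ := by group
    _ = (g * y) * y⁻¹ * g⁻¹ := by rw [h]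
    _ = 1 := by group

/-- If the commutators with `g` generate a CENTRAL normal subgroup of a perfect group, then `g` is
central (conjugation by `g` is then an automorphism that is the identity modulo the centre). -/
theorem mem_center_of_normalClosure_commutators_le_center (hG : commutator G = ⊤) {g : G}
    (h : normalClosure (Set.range fun y : G => ⁅y, g⁆) ≤ center G) : g ∈ center G := by
  have hα : ∀ y : G, y⁻¹ * (MulAut.conj g).toMonoidHom y ∈ center G := by
    intro y
    have hmem : ⁅y⁻¹, g⁆ ∈ normalClosure (Set.range fun y : G => ⁅y, g⁆) :=
      subset_normalClosure ⟨y⁻¹, rfl⟩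
    have := h hmem
    simpa [commutatorElement_def, MulAut.conj_apply, mul_assoc] using this
  have key := PerfectProd.eq_self_of_perfect_of_central_difference hG
    (MulAut.conj g).toMonoidHom hα
  rw [Subgroup.mem_center_iff]
  intro y
  have hy : g * y * g⁻¹ = y := by simpa [MulAut.conj_apply] using key y
  calc y * g = (g * y * g⁻¹) * g := by rw [hy]
    _ = g * y := by group

/-- KILLING CLASS ⟺ NONCENTRAL.  For a nontrivial perfect group all of whose normal subgroups are
central or everything (e.g. the binary icosahedral group `SL(2,5)`), the quotient by the commutators
with `g` is trivial iff `g` is not central. -/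
theorem normalClosure_commutators_eq_top_iff [Nontrivial G] (hG : commutator G = ⊤)
    (hnorm : ∀ N : Subgroup G, N.Normal → N ≤ center G ∨ N = ⊤) (g : G) :
    normalClosure (Set.range fun y : G => ⁅y, g⁆) = ⊤ ↔ g ∉ center G := by
  constructor
  · intro htop hg
    have hbot := normalClosure_commutators_eq_bot_of_mem_center hg
    rw [htop] at hbot
    exact top_ne_bot hbot
  · intro hg
    rcases hnorm _ (Subgroup.normalClosure_normal (s := Set.range fun y : G => ⁅y, g⁆)) with h | h
    · exact absurd (mem_center_of_normalClosure_commutators_le_center hG h) hg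
    · exact h

/-- The same statement for the section relators of an inner monodromy `μ_q` and section class
`w · t`: the surgered mapping torus is simply connected iff `w q` is not central. -/
theorem normalClosure_sectionRelators_conj_eq_top_iff [Nontrivial G] (hG : commutator G = ⊤)
    (hnorm : ∀ N : Subgroup G, N.Normal → N ≤ center G ∨ N = ⊤) (q w : G) :
    normalClosure (sectionRelators (MulAut.conj q).toMonoidHom w) = ⊤ ↔ w * q ∉ center G := by
  rw [sectionRelators_conj_eq]
  exact normalClosure_commutators_eq_top_iff hG hnorm (w * q)

/-! ### The cyclic factor: inversion contributes squares -/

section Product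

variable {A : Type*} [CommGroup A]

/-- In a commutative group with the inversion automorphism the section relator at `a` is `a⁻²`
(independently of the section class `b`). -/
theorem inversionRelator (b a : A) : a⁻¹ * b * a⁻¹ * b⁻¹ = (a ^ 2)⁻¹ := by
  rw [pow_two, mul_inv_rev]
  calc a⁻¹ * b * a⁻¹ * b⁻¹ = a⁻¹ * a⁻¹ * (b * b⁻¹) := by
        simp only [mul_comm, mul_left_comm, mul_assoc]
    _ = a⁻¹ * a⁻¹ := by rw [mul_inv_cancel, mul_one]

/-- The monodromy `μ_q × (a ↦ a⁻¹)` on `G × A` as a group endomorphism. -/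
def conjProdInv (q : G) : G × A →* G × A :=
  ((MulAut.conj q).toMonoidHom.comp (MonoidHom.fst G A)).prod
    ((MonoidHom.id A)⁻¹ |>.comp (MonoidHom.snd G A))

/-- `conjProdInv q (x, a) = (q x q⁻¹, a⁻¹)`. -/
@[simp] theorem conjProdInv_apply (q : G) (x : G × A) :
    conjProdInv (A := A) q x = (q * x.1 * q⁻¹, x.2⁻¹) := by
  rcases x with ⟨x, a⟩
  simp [conjProdInv, MulAut.conj_apply]

/-- The section relators of `μ_q × inv` on `G × A` at `(x, a)`, for the section class `(w, b) · t`,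
are `(x⁻¹ w q x q⁻¹ w⁻¹, a⁻²)`. -/
theorem sectionRelator_prod (q w x : G) (b a : A) :
    (x, a)⁻¹ * (w, b) * conjProdInv (A := A) q (x, a) * (w, b)⁻¹ =
      (x⁻¹ * w * (q * x * q⁻¹) * w⁻¹, (a ^ 2)⁻¹) := by
  rw [conjProdInv_apply]
  simp only [Prod.inv_mk, Prod.mk_mul_mk, inversionRelator]

/-- Projection: the image of the product relator set in `G` is the relator set of `μ_q`, so if the
product quotient is trivial then so is `G / ⟪⁅y, w q⁆⟫` — in particular `w q` is not central
(for `G` as in `normalClosure_commutators_eq_top_iff`). -/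
theorem normalClosure_sectionRelators_fst (q w : G) (b : A)
    (h : normalClosure (sectionRelators (conjProdInv (A := A) q) (w, b)) = ⊤) :
    normalClosure (sectionRelators (MulAut.conj q).toMonoidHom w) = ⊤ := by
  have hsurj : Function.Surjective (MonoidHom.fst G A) := fun x => ⟨(x, 1), rfl⟩
  have himg : (MonoidHom.fst G A) '' sectionRelators (conjProdInv (A := A) q) (w, b) =
      sectionRelators (MulAut.conj q).toMonoidHom w := by
    ext z
    constructor
    · rintro ⟨_, ⟨⟨x, a⟩, rfl⟩, rfl⟩
      refine ⟨x, ?_⟩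
      simp [MulAut.conj_apply]
    · rintro ⟨x, rfl⟩
      refine ⟨((x, (1 : A))⁻¹ * (w, b) * conjProdInv (A := A) q (x, 1) * (w, b)⁻¹), ⟨(x, 1), rfl⟩, ?_⟩
      simp [MulAut.conj_apply]
  have := Subgroup.map_normalClosure (sectionRelators (conjProdInv (A := A) q) (w, b))
    (MonoidHom.fst G A) hsurj
  rw [h, himg, Subgroup.map_top_of_surjective _ hsurj] at this
  exact this.symm

/-- Assembly of the product case: if `G / ⟪⁅y, w q⁆⟫ = 1` and every element of `A` is a square
(e.g. `A = ℤ_d` with `d` odd), then surgery on the mapping torus of `μ_q × inv` on `G × A` along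
ANY section of `G`-class `w` gives a simply connected manifold:
the normal closure of the product relators is everything. -/
theorem normalClosure_sectionRelators_prod_eq_top (q w : G) (b : A)
    (hGq : normalClosure (sectionRelators (MulAut.conj q).toMonoidHom w) = ⊤)
    (hsq : ∀ a : A, ∃ c : A, c ^ 2 = a) :
    normalClosure (sectionRelators (conjProdInv (A := A) q) (w, b)) = ⊤ := by
  set N := normalClosure (sectionRelators (conjProdInv (A := A) q) (w, b)) with hN
  -- (1) the `A`-factor is contained in `N`: `(1, a⁻¹)` is the relator at `(1, c)` with `c² = a`.
  have hA : ∀ a : A, ((1 : G), a) ∈ N := by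
    intro a
    obtain ⟨c, hc⟩ := hsq a⁻¹
    have hrel : ((1 : G), c)⁻¹ * (w, b) * conjProdInv (A := A) q (1, c) * (w, b)⁻¹ ∈ N :=
      subset_normalClosure (mem_sectionRelators _ _ _)
    rw [sectionRelator_prod, hc, inv_inv] at hrel
    simpa using hrel
  -- (2) the `G`-relators `(r, 1)` lie in `N`: `(r, (a²)⁻¹) ∈ N` and `(1, (a²)⁻¹) ∈ N`.
  have hGrel : ∀ x : G, (x⁻¹ * w * (q * x * q⁻¹) * w⁻¹, (1 : A)) ∈ N := by
    intro x
    have hrel : (x, (1 : A))⁻¹ * (w, b) * conjProdInv (A := A) q (x, 1) * (w, b)⁻¹ ∈ N :=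
      subset_normalClosure (mem_sectionRelators _ _ _)
    rw [sectionRelator_prod] at hrel
    simpa using hrel
  -- (3) hence `G × 1 ≤ N`: the preimage of `N` under `inl` is a normal subgroup containing the
  --     relators of `μ_q`, so it is everything by `hGq`.
  have hcomap : normalClosure (sectionRelators (MulAut.conj q).toMonoidHom w) ≤
      N.comap (MonoidHom.inl G A) := by
    refine normalClosure_le_normal ?_
    rintro _ ⟨x, rfl⟩
    rw [SetLike.mem_coe, Subgroup.mem_comap]
    simpa [MulAut.conj_apply] using hGrel x
  rw [hGq] at hcomap
  have hG1 : ∀ x : G, (x, (1 : A)) ∈ N := fun x => by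
    have := hcomap (Subgroup.mem_top x)
    simpa using this
  -- (4) `(x, a) = (x, 1) · (1, a)`.
  rw [eq_top_iff]
  rintro ⟨x, a⟩ -
  have := N.mul_mem (hG1 x) (hA a)
  simpa using this

end Product

end SectionSurgery
end Summit.SmoothPoincare4.SmoothPoincare4.Theorems
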